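import Literature.Analysis.FluidPDE.AxisymNoSwirlNashDecay
import Literature.Analysis.FluidPDE.AxisymBiotSavartRadialBound
import HarnessLib

/-!
# Axisymmetric flows without swirl: decay of the radial strain `u_r/r`
# (Gallay–Šverák 2015, proof of Prop. 5.3: `‖u_r(t)/r‖_∞ ≤ C M / t`)

Analysis/FluidPDE proof file (theorems only; no definitions, no named facts).

In the proof of their Proposition 5.3, Gallay and Šverák combine the kinematic estimate (2.15),
`‖u_r/r‖_{L^∞} ≤ C‖ω_θ‖_{L¹(Ω)}^{1/3}‖ω_θ/r‖_{L^∞}^{2/3}` (Prop. 2.6, the tree's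
`IsTaoSolutionOn.abs_radVelQuot_le_of_abs_angVortQuot_le`, `AxisymBiotSavartRadialBound`), with
Lemma 5.2 for `p = ∞`, `‖ω_θ(t)/r‖_{L^∞} ≤ C t^{−3/2}‖ω₀/r‖_{L¹}` (the tree's
`IsTaoSolutionOn.abs_angVortQuot_le_nash_of_datum`, `AxisymNoSwirlNashDecay`), and Lemma 5.1
(`‖ω_θ(t)‖_{L¹(Ω)} ≤ M`):

> `‖u_r(t)/r‖_{L^∞(Ω)} ≤ C ‖ω_θ(t)‖_{L¹(Ω)}^{1/3} ‖ω_θ(t)/r‖_{L^∞(Ω)}^{2/3} ≤ C M / t`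

(arXiv:1510.01036, p. 17, first display of the proof of Prop. 5.3; `M = ‖ω₀‖_{L¹(Ω)}`). This file
records that consequence as a tree theorem along Tao-class axisymmetric swirl-free flows, with
explicit constants (`A = ∫|η₀| dx = 2πM`, `K₁ = max(K_GNS, 1)`):

* `IsTaoSolutionOn.abs_radVelQuot_le_nash_of_datum` — **the radial strain decays like `1/(νt)`**:
  `|(u_r/r)(t, x)| ≤ (27 K₁²/(4ν)) ‖η₀‖_{L¹} t⁻¹` for `t ∈ (0, T]` and every `x`;
* `IsTaoSolutionOn.abs_radialVelocity_le_nash_of_datum` — `|u_r(t, x)| ≤ (27 K₁²/(4ν)) ‖η₀‖_{L¹} r(x) t⁻¹`.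

(`(9/2)·(A·L²)^{1/3}` with `L = (3K₁²/(2ν))^{3/2} A t^{−3/2}` equals `(9/2)(3K₁²/(2ν)) A t⁻¹`.)

What is NOT here: the `L²(Ω)` energy inequality (5.8)–(5.9) for `ω_θ` and Prop. 5.3 itself (the tree's
named fact `GallaySverak2015.VorticitySupBound` for `p = ∞`).

## Mathlib / tree search

Tree (all used): `IsTaoSolutionOn.abs_radVelQuot_le_of_abs_angVortQuot_le`,
`…abs_radialVelocity_le_of_abs_angVortQuot_le` (p501840), `IsTaoSolutionOn.abs_angVortQuot_le_nash_of_datum`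
(`AxisymNoSwirlNashDecay`). `lean search 'radVelQuot_le_nash|StrainDecay'` (2026-08-27): nothing.
Mathlib: `Real.pow_rpow_inv_natCast`, `Real.rpow_*`.

## References

* Th. Gallay, V. Šverák, *Remarks on the Cauchy problem for the axisymmetric Navier–Stokes
  equations*, Confluentes Math. 7 (2015) 67–92 = arXiv:1510.01036, proof of Prop. 5.3, first display
  (arXiv p. 17), with Prop. 2.6 (2.15) (p. 8) and Lemma 5.2 (p. 16). [GallaySverak2016]
* H. Feng, V. Šverák, Arch. Ration. Mech. Anal. 215 (2015) = arXiv:1301.6317, Lemma 3.8 (p. 12).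
  [FengSverak2015]
-/

noncomputable section

open MeasureTheory Set Function Filter Topology InnerProductSpace WithLp
open scoped RealInnerProductSpace ContDiff ENNReal NNReal Topology

namespace Literature.Analysis.FluidPDE

section StrainDecay

variable {T ν : ℝ} {u₀ : EuclideanSpace ℝ (Fin 3) → EuclideanSpace ℝ (Fin 3)}
  {u : ℝ → EuclideanSpace ℝ (Fin 3) → EuclideanSpace ℝ (Fin 3)} {p : ℝ → EuclideanSpace ℝ (Fin 3) → ℝ}

/-- The arithmetic of the two constants: with `D = 3K₁²/(2ν)`, `L = D^{3/2} A t^{−3/2}`,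
`A · L² = (D A t⁻¹)³`, hence `(A L²)^{1/3} = D A t⁻¹`. [folklore] -/
private theorem rpow_third_mul_sq_eq {D A t : ℝ} (hD : 0 ≤ D) (hA : 0 ≤ A) (ht : 0 < t) :
    (A * (D ^ (3 / 2 : ℝ) * A * t ^ (-(3 / 2 : ℝ))) ^ 2) ^ (1 / 3 : ℝ) = D * A * t⁻¹ := by
  have hD3 : (D ^ (3 / 2 : ℝ)) ^ 2 = D ^ 3 := by
    rw [← Real.rpow_natCast (D ^ (3 / 2 : ℝ)) 2, ← Real.rpow_mul hD, ← Real.rpow_natCast D 3]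
    norm_num
  have ht3 : (t ^ (-(3 / 2 : ℝ))) ^ 2 = t⁻¹ ^ 3 := by
    rw [← Real.rpow_natCast (t ^ (-(3 / 2 : ℝ))) 2, ← Real.rpow_mul ht.le, ← Real.rpow_neg_one,
      ← Real.rpow_natCast (t ^ (-1 : ℝ)) 3, ← Real.rpow_mul ht.le]
    norm_num
  have hcube : A * (D ^ (3 / 2 : ℝ) * A * t ^ (-(3 / 2 : ℝ))) ^ 2 = (D * A * t⁻¹) ^ 3 := by
    rw [show (D ^ (3 / 2 : ℝ) * A * t ^ (-(3 / 2 : ℝ))) ^ 2 =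
      (D ^ (3 / 2 : ℝ)) ^ 2 * A ^ 2 * (t ^ (-(3 / 2 : ℝ))) ^ 2 by ring, hD3, ht3]
    ring
  rw [hcube, one_div]
  exact Real.pow_rpow_inv_natCast (mul_nonneg (mul_nonneg hD hA) (inv_nonneg.2 ht.le)) three_ne_zero

/-- **Gallay–Šverák 2015, proof of Prop. 5.3, first display: the radial strain `u_r/r` decays like
`‖ω₀‖_{L¹(Ω)}/(νt)`.** Let `(u, p)` be a Tao-class solution of the unforced Navier–Stokes system on
`[0, T] × ℝ³` with viscosity `ν > 0` whose datum `u₀` is axisymmetric WITHOUT swirl with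
`η₀ = ω_θ(0)/r = angVortQuot u₀ ∈ L¹(ℝ³)`, `A = ∫ |η₀| dx` (`= 2π‖ω₀‖_{L¹(Ω)}`). Then for `t ∈ (0, T]`
and every `x`, the smooth radial quotient `radVelQuot (u t) = (x₀u₀ + x₁u₁)/r² = u_r/r` obeys

  `|(u_r/r)(t, x)| ≤ (27 K₁² / (4ν)) · A · t⁻¹`,  `K₁ = max(K_GNS, 1)`

— the printed `‖u_r(t)/r‖_{L^∞(Ω)} ≤ C‖ω_θ(t)‖_{L¹(Ω)}^{1/3}‖ω_θ(t)/r‖_{L^∞(Ω)}^{2/3} ≤ CM/t`: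
(2.15) (`IsTaoSolutionOn.abs_radVelQuot_le_of_abs_angVortQuot_le`, constant `9/2`) fed with Lemma 5.2
for `p = ∞` (`IsTaoSolutionOn.abs_angVortQuot_le_nash_of_datum`, `L = (3K₁²/(2ν))^{3/2} A t^{−3/2}`) and
Lemma 5.1; `(9/2)(A L²)^{1/3} = (9/2)(3K₁²/(2ν)) A t⁻¹`.
[cite: GallaySverak2016, proof of Prop. 5.3, first display (arXiv p. 17), with Prop. 2.6 (2.15) and Lemma 5.2] -/
theorem IsTaoSolutionOn.abs_radVelQuot_le_nash_of_datum (h : IsTaoSolutionOn T ν u₀ u p)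
    (hT : 0 < T) (hν : 0 < ν) (h0 : IsAxisymmetric u₀) (h0' : HasNoSwirl u₀)
    (hL1 : Integrable (angVortQuot u₀)) {t : ℝ} (ht : t ∈ Ioc 0 T) (x : EuclideanSpace ℝ (Fin 3)) :
    |radVelQuot (u t) x| ≤
      27 * (max ((SNormLESNormFDerivOfEqConst ℝ (volume : Measure (EuclideanSpace ℝ (Fin 3))) 2 : ℝ)) 1) ^ 2 /
        (4 * ν) * (∫ y, |angVortQuot u₀ y|) * t⁻¹ := by
  set K₁ : ℝ := max ((SNormLESNormFDerivOfEqConst ℝ (volume : Measure (EuclideanSpace ℝ (Fin 3))) 2 : ℝ)) 1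
    with hK₁def
  set A : ℝ := ∫ y, |angVortQuot u₀ y| with hAdef
  set D : ℝ := 3 * K₁ ^ 2 / (2 * ν) with hDdef
  have hK₁0 : 0 < K₁ := one_pos.trans_le (le_max_right _ _)
  have hD : 0 ≤ D := by rw [hDdef]; positivity
  have hA : 0 ≤ A := integral_nonneg fun y => abs_nonneg _
  have htI : t ∈ Icc 0 T := ⟨ht.1.le, ht.2⟩
  -- Lemma 5.2, `p = ∞`
  have hL : ∀ y, |angVortQuot (u t) y| ≤ D ^ (3 / 2 : ℝ) * A * t ^ (-(3 / 2 : ℝ)) := fun y =>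
    h.abs_angVortQuot_le_nash_of_datum hT hν h0 h0' hL1 ht y
  -- (2.15) with this `L`
  have hq := h.abs_radVelQuot_le_of_abs_angVortQuot_le hT hν h0 h0' hL1 htI hL x
  rw [rpow_third_mul_sq_eq hD hA ht.1] at hq
  refine hq.trans_eq ?_
  rw [hDdef]
  ring

/-- **The radial velocity along the flow**: under the same hypotheses,
`|u_r(t, x)| ≤ (27 K₁²/(4ν)) · A · r(x) · t⁻¹` for `t ∈ (0, T]` and every `x` (`r = cylRadius`; the
radial form of (2.15), `IsTaoSolutionOn.abs_radialVelocity_le_of_abs_angVortQuot_le`, fed with Lemma 5.2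
for `p = ∞`). [cite: GallaySverak2016, proof of Prop. 5.3, first display (arXiv p. 17), with Prop. 2.6 (2.15) and Lemma 5.2] -/
theorem IsTaoSolutionOn.abs_radialVelocity_le_nash_of_datum (h : IsTaoSolutionOn T ν u₀ u p)
    (hT : 0 < T) (hν : 0 < ν) (h0 : IsAxisymmetric u₀) (h0' : HasNoSwirl u₀)
    (hL1 : Integrable (angVortQuot u₀)) {t : ℝ} (ht : t ∈ Ioc 0 T) (x : EuclideanSpace ℝ (Fin 3)) :
    |radialVelocity (u t) x| ≤
      27 * (max ((SNormLESNormFDerivOfEqConst ℝ (volume : Measure (EuclideanSpace ℝ (Fin 3))) 2 : ℝ)) 1) ^ 2 /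
        (4 * ν) * (∫ y, |angVortQuot u₀ y|) * cylRadius x * t⁻¹ := by
  set K₁ : ℝ := max ((SNormLESNormFDerivOfEqConst ℝ (volume : Measure (EuclideanSpace ℝ (Fin 3))) 2 : ℝ)) 1
    with hK₁def
  set A : ℝ := ∫ y, |angVortQuot u₀ y| with hAdef
  set D : ℝ := 3 * K₁ ^ 2 / (2 * ν) with hDdef
  have hK₁0 : 0 < K₁ := one_pos.trans_le (le_max_right _ _)
  have hD : 0 ≤ D := by rw [hDdef]; positivity
  have hA : 0 ≤ A := integral_nonneg fun y => abs_nonneg _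
  have htI : t ∈ Icc 0 T := ⟨ht.1.le, ht.2⟩
  have hL : ∀ y, |angVortQuot (u t) y| ≤ D ^ (3 / 2 : ℝ) * A * t ^ (-(3 / 2 : ℝ)) := fun y =>
    h.abs_angVortQuot_le_nash_of_datum hT hν h0 h0' hL1 ht y
  have hq := (h.abs_radialVelocity_le_of_abs_angVortQuot_le hT hν h0 h0' hL1 htI hL x).1
  rw [rpow_third_mul_sq_eq hD hA ht.1] at hq
  refine hq.trans_eq ?_
  rw [hDdef]
  ring

end StrainDecay

end Literature.Analysis.FluidPDE
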